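import Mathlib.Analysis.Calculus.LineDeriv.IntegrationByParts
import Mathlib.MeasureTheory.Integral.Bochner.ContinuousLinearMap
import Mathlib.Analysis.SpecialFunctions.JapaneseBracket
import Literature.Analysis.FluidPDE.TaoEnstrophyLocalisation
import Literature.Analysis.FluidPDE.NSWave0
import HarnessLib

/-!
# The total vorticity flux `Ω₃ = ∫ ω dx` of an integrable velocity field vanishes

Analysis/FluidPDE file (theorems only). Majda–Bertozzi 2002, §1.7 Prop. 1.12 (ii), eq. (1.65)
(print p. 24) lists among the conserved quantities of smooth decaying Euler solutions on `ℝ³`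
«(ii) the total flux `Ω₃` of vorticity, `Ω₃ = ∫_{ℝ³} ω dx`». For a velocity field that is
integrable together with its first derivatives (in particular for compactly supported or
Schwartz-class `C¹` fields) this invariant is IDENTICALLY ZERO at every time: each component of
`ω = curl u` is a difference `∂ⱼu_k − ∂_k u_j` of derivatives, and `∫ ∂ᵥh = 0` on the whole space
(Leray 1934, §6 (1.11): «`∫ (u ∂ᵢa + ∂ᵢu a) dy = 0`», with `a ≡ 1`; the tree's
`integral_fderiv_apply_eq_zero` is the compact-support case). Consequently the conservation of `Ω₃`
carries NO information on `‖ω‖` in any norm — the mechanism behind the failure class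
«a-priori-bound-by-identity» (barrier `Literature.Barriers.NavierStokesRegularity.VortexStretching.
VortexStretchingAprioriBounds`): a signed integral invariant promoted to norm control.

* `integral_fderiv_apply_eq_zero_of_integrable` — `∫ Dh(x)[v] dx = 0` for `h ∈ C¹` with `h` and
  `Dh(·)[v]` integrable (no compact support);
* `integral_fderiv_eq_zero_of_integrable` — `∫ Dh = 0` as a continuous linear map;
* `integral_curl_eq_zero_of_integrable` — `∫ curl u = 0` for `u ∈ C¹(ℝ³; ℝ³)` with `u`, `Du`
  integrable; `integral_curl_eq_zero` — the compactly supported case.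

## References

* [MajdaBertozziCUP2002] A. J. Majda, A. L. Bertozzi, *Vorticity and Incompressible Flow*, CUP 2002,
  §1.7 Prop. 1.12 (ii), eq. (1.65), p. 24.
* [Leray1934] J. Leray, Acta Math. 63 (1934), §6 eq. (1.11), p. 203.

WHAT THIS IS NOT: not a claim about NS regularity or blow-up.
-/

noncomputable section

open MeasureTheory Set Function

namespace Literature.Analysis.FluidPDE

section General

variable {E : Type*} [NormedAddCommGroup E] [InnerProductSpace ℝ E] [FiniteDimensional ℝ E]
  [MeasurableSpace E] [BorelSpace E]
variable {F : Type*} [NormedAddCommGroup F] [NormedSpace ℝ F]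

/-- **No boundary terms on the whole space, integrable version**: for `h ∈ C¹(E; F)` with `h` and
the directional derivative `Dh(·)[v]` integrable, `∫ Dh(x)[v] dx = 0` (Leray 1934, §6 (1.11) with
`a ≡ 1`: `∫ ∂ᵢu dy = 0`; Mathlib's integration by parts against the constant function `1`).
[cite: Leray1934, §6 eq. (1.11) p. 203] -/
theorem integral_fderiv_apply_eq_zero_of_integrable {h : E → F} (hh : ContDiff ℝ 1 h)
    (hi : Integrable h) (v : E) (hi' : Integrable fun x => fderiv ℝ h x v) :
    ∫ x, fderiv ℝ h x v = 0 := by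
  have key := integral_bilinear_hasFDerivAt_right_eq_neg_left_of_integrable (μ := volume)
    (f := fun _ : E => (1 : ℝ)) (f' := fun _ => (0 : E →L[ℝ] ℝ)) (g := h) (g' := fderiv ℝ h)
    (v := v) (B := ContinuousLinearMap.lsmul ℝ ℝ) ?_ ?_ ?_ ?_ ?_
  · simpa using key
  · simp
  · simpa using hi'
  · simpa using hi
  · intro x _
    exact hasFDerivAt_const _ _
  · intro x _
    exact (hh.differentiable one_ne_zero x).hasFDerivAt

/-- The same for the full derivative: `∫ Dh(x) dx = 0` in `E →L[ℝ] F`, for `h ∈ C¹` with `h` and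
`Dh` integrable. [cite: Leray1934, §6 eq. (1.11) p. 203] -/
theorem integral_fderiv_eq_zero_of_integrable {h : E → F} (hh : ContDiff ℝ 1 h)
    (hi : Integrable h) (hD : Integrable fun x => fderiv ℝ h x) :
    ∫ x, fderiv ℝ h x = 0 := by
  ext v
  rw [ContinuousLinearMap.integral_apply hD v, zero_apply]
  exact integral_fderiv_apply_eq_zero_of_integrable hh hi v
    ((ContinuousLinearMap.apply ℝ F v).integrable_comp hD)

end General

/-- **The total vorticity flux vanishes**: for `u ∈ C¹(ℝ³; ℝ³)` with `u` and `Du` integrable,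
`Ω₃ = ∫ curl u dx = 0` — Majda–Bertozzi's conserved quantity (1.65) is identically zero for
integrable flows (each component of `curl u = curlCLM (Du)` is a combination of entries of `Du`,
whose integrals vanish). [cite: MajdaBertozziCUP2002, §1.7 Prop. 1.12 (ii) eq. (1.65), p. 24] -/
theorem integral_curl_eq_zero_of_integrable
    {u : EuclideanSpace ℝ (Fin 3) → EuclideanSpace ℝ (Fin 3)} (hu : ContDiff ℝ 1 u)
    (hi : Integrable u) (hD : Integrable fun x => fderiv ℝ u x) :
    ∫ x, curl u x = 0 := by
  rw [curl_eq_curlCLM_comp]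
  change ∫ x, curlCLM (fderiv ℝ u x) = 0
  rw [curlCLM.integral_comp_comm hD, integral_fderiv_eq_zero_of_integrable hu hi hD, map_zero]

/-- **The total vorticity of a compactly supported `C¹` velocity field vanishes**:
`∫ curl u dx = 0`. [cite: MajdaBertozziCUP2002, §1.7 Prop. 1.12 (ii) eq. (1.65), p. 24] -/
theorem integral_curl_eq_zero {u : EuclideanSpace ℝ (Fin 3) → EuclideanSpace ℝ (Fin 3)}
    (hu : ContDiff ℝ 1 u) (hc : HasCompactSupport u) : ∫ x, curl u x = 0 :=
  integral_curl_eq_zero_of_integrable hu (hu.continuous.integrable_of_hasCompactSupport hc)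
    ((hu.continuous_fderiv one_ne_zero).integrable_of_hasCompactSupport (hc.fderiv (𝕜 := ℝ)))

/-- The same with an amplitude: `∫ curl (A • u) = 0` for every `A`, while `curl (A • u) = A • curl u`
pointwise — the conserved total flux is blind to the size of the vorticity. [cite: MajdaBertozziCUP2002, §1.7 Prop. 1.12 (ii) eq. (1.65), p. 24] -/
theorem integral_curl_smul_eq_zero {u : EuclideanSpace ℝ (Fin 3) → EuclideanSpace ℝ (Fin 3)}
    (hu : ContDiff ℝ 1 u) (hc : HasCompactSupport u) (A : ℝ) :
    ∫ x, curl (A • u) x = 0 :=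
  integral_curl_eq_zero (contDiff_const.smul hu) (hc.smul_left)

/-! ### Appendix (rev 2): rapidly decaying fields — `Ω₃(t) = 0` along any Clay-class flow -/

section Decay

variable {E : Type*} [NormedAddCommGroup E] [InnerProductSpace ℝ E] [FiniteDimensional ℝ E]
  [MeasurableSpace E] [BorelSpace E]
variable {F : Type*} [NormedAddCommGroup F] [NormedSpace ℝ F]

/-- A rapidly decaying field (Fefferman's (4): `(1+|x|)^K |D^n u₀(x)| ≤ C_{nK}` for all `n, K`) has
every continuous derivative integrable: `D^n u₀ ∈ L¹` (domination by `C (1+|x|)^{-(d+1)}`,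
Mathlib `integrable_one_add_norm`). [cite: MajdaBertozziCUP2002, §1.7 Prop. 1.12 («vanishing sufficiently rapidly as |x| ↗ ∞»), p. 24] -/
theorem HasRapidSpatialDecay.integrable_iteratedFDeriv {u₀ : E → F} (h : HasRapidSpatialDecay u₀)
    {n : ℕ} (hc : Continuous (iteratedFDeriv ℝ n u₀)) :
    Integrable (iteratedFDeriv ℝ n u₀) (volume : Measure E) := by
  set K : ℕ := Module.finrank ℝ E + 1 with hK
  obtain ⟨C, hC⟩ := h n K
  have hr : (Module.finrank ℝ E : ℝ) < (K : ℝ) := by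
    rw [hK]; push_cast; linarith
  refine Integrable.mono' ((integrable_one_add_norm hr).const_mul C) hc.aestronglyMeasurable
    (Filter.Eventually.of_forall fun x => ?_)
  have hx : 0 < 1 + ‖x‖ := by positivity
  have h1 : ‖iteratedFDeriv ℝ n u₀ x‖ ≤ C / (1 + ‖x‖) ^ K := by
    rw [le_div_iff₀ (by positivity), mul_comm]
    exact hC x
  calc ‖iteratedFDeriv ℝ n u₀ x‖ ≤ C / (1 + ‖x‖) ^ K := h1
    _ = C * (1 + ‖x‖) ^ (-(K : ℝ)) := by
        rw [Real.rpow_neg hx.le, Real.rpow_natCast, div_eq_mul_inv]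

/-- A continuous rapidly decaying field is integrable. [cite: MajdaBertozziCUP2002, §1.7 Prop. 1.12, p. 24] -/
theorem HasRapidSpatialDecay.integrable {u₀ : E → F} (h : HasRapidSpatialDecay u₀)
    (hu : Continuous u₀) : Integrable u₀ (volume : Measure E) := by
  have h0 : Continuous (iteratedFDeriv ℝ 0 u₀) := by
    rw [iteratedFDeriv_zero_eq_comp]
    exact (continuousMultilinearCurryFin0 ℝ E F).symm.continuous.comp hu
  have hi := h.integrable_iteratedFDeriv h0
  refine hi.norm.mono' hu.aestronglyMeasurable (Filter.Eventually.of_forall fun x => ?_)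
  rw [norm_iteratedFDeriv_zero]

/-- The derivative of a `C¹` rapidly decaying field is integrable. [cite: MajdaBertozziCUP2002, §1.7 Prop. 1.12, p. 24] -/
theorem HasRapidSpatialDecay.integrable_fderiv {u₀ : E → F} (h : HasRapidSpatialDecay u₀)
    (hu : ContDiff ℝ 1 u₀) : Integrable (fun x => fderiv ℝ u₀ x) (volume : Measure E) := by
  have h1 : Continuous (iteratedFDeriv ℝ 1 u₀) :=
    hu.continuous_iteratedFDeriv le_rfl
  have hi := h.integrable_iteratedFDeriv h1
  refine hi.norm.mono' (hu.continuous_fderiv one_ne_zero).aestronglyMeasurable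
    (Filter.Eventually.of_forall fun x => ?_)
  rw [norm_iteratedFDeriv_one]

end Decay

/-- **`Ω₃ = 0` for every Clay-class field**: for `u ∈ C¹(ℝ³; ℝ³)` rapidly decaying (Fefferman's
(4)), `∫ curl u dx = 0`. Along a smooth solution whose slices stay rapidly decaying, Majda–Bertozzi's
conserved total vorticity flux (1.65) is therefore `0` at all times — it bounds no norm of `ω`.
[cite: MajdaBertozziCUP2002, §1.7 Prop. 1.12 (ii) eq. (1.65), p. 24] -/
theorem integral_curl_eq_zero_of_hasRapidSpatialDecay
    {u : EuclideanSpace ℝ (Fin 3) → EuclideanSpace ℝ (Fin 3)} (hu : ContDiff ℝ 1 u)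
    (h : HasRapidSpatialDecay u) : ∫ x, curl u x = 0 :=
  integral_curl_eq_zero_of_integrable hu (h.integrable hu.continuous) (h.integrable_fderiv hu)

/-- The vorticity of a `C¹` rapidly decaying field is integrable (`‖curl u‖ ≤ ‖curlCLM‖ ‖Du‖`).
[cite: MajdaBertozziCUP2002, §1.7 Prop. 1.12 (ii) eq. (1.65), p. 24] -/
theorem integrable_curl_of_hasRapidSpatialDecay
    {u : EuclideanSpace ℝ (Fin 3) → EuclideanSpace ℝ (Fin 3)} (hu : ContDiff ℝ 1 u)
    (h : HasRapidSpatialDecay u) : Integrable (curl u) := by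
  rw [curl_eq_curlCLM_comp]
  exact curlCLM.integrable_comp (h.integrable_fderiv hu)

/-- Componentwise form: `∫ ωᵢ dx = 0`, `i = 1, 2, 3`, for a `C¹` rapidly decaying velocity field.
[cite: MajdaBertozziCUP2002, §1.7 Prop. 1.12 (ii) eq. (1.65), p. 24] -/
theorem integral_curl_apply_eq_zero_of_hasRapidSpatialDecay
    {u : EuclideanSpace ℝ (Fin 3) → EuclideanSpace ℝ (Fin 3)} (hu : ContDiff ℝ 1 u)
    (h : HasRapidSpatialDecay u) (i : Fin 3) : ∫ x, curl u x i = 0 := by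
  have hint := integrable_curl_of_hasRapidSpatialDecay hu h
  have hcomp : ∫ x, (EuclideanSpace.proj i : EuclideanSpace ℝ (Fin 3) →L[ℝ] ℝ) (curl u x) =
      (EuclideanSpace.proj i : EuclideanSpace ℝ (Fin 3) →L[ℝ] ℝ) (∫ x, curl u x) :=
    (EuclideanSpace.proj i : EuclideanSpace ℝ (Fin 3) →L[ℝ] ℝ).integral_comp_comm hint
  calc ∫ x, curl u x i
      = ∫ x, (EuclideanSpace.proj i : EuclideanSpace ℝ (Fin 3) →L[ℝ] ℝ) (curl u x) := rfl
    _ = (EuclideanSpace.proj i : EuclideanSpace ℝ (Fin 3) →L[ℝ] ℝ) (∫ x, curl u x) := hcomp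
    _ = 0 := by rw [integral_curl_eq_zero_of_hasRapidSpatialDecay hu h]; simp

end Literature.Analysis.FluidPDE
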